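import Summits.Parity.GeneralizedHardyLittlewood.Theorems.LiouvilleShiftedTablesTypeI2DilatedAssemble4

/-!
# THE ASSEMBLY of the line `peel-to-drappeau` for the crux `TypeI2Dilated` (stmt-Parity-14272)

Part 5/6: dyadic blocks of `sRange`, the dispersion range at a fixed `(q, r)` (`disp_pointwise`), reordering of iterated sums, and the combinatorial reduction of the crux left side to five pieces (`lhs_le_pieces`); second module docstring = the paper proof with constants and the audit.

Route `LiouvilleShiftedTables` (Parity / GeneralizedHardyLittlewood); registered skeleton
`Cruxes/TypeI2Dilated/Lines/peel-to-drappeau.lean` (v6), stub `stub_assembleFrom : AssembleFrom` where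
`AssembleFrom := URBound → (DilatedTypeII → DilatedMainTerms → DilatedDivisorAP → BVLiouville → TypeI2Dilated)`
(vocabulary in `Summits.Parity.GeneralizedHardyLittlewood.Theorems.LiouvilleShiftedTablesDefs`).  The paper proof with constants and the audit of the four inputs is the
second module docstring of part 5. [this line: Lines/peel-to-drappeau.md]
-/

/-!
## Paper proof of THE ASSEMBLY, with constants, and audit of the four inputs (skeleton v6)

Notation.  Fix `c ≠ 0`.  For `x, w, R, S, y` as in the crux and `q, r, s ≥ 1` put
`Z = ⌊y/(sr)⌋`, `I(q,r,s) = ∑_{n ≤ Z, rsn ≡ w (q)} λ(rsn + c)` (`innerSum`; `λ(m) := λ(toNat m)`, so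
`λ(m) = 0` for `m ≤ 0`), so that the crux left side is `LHS = ∑_{q ≤ x^ρ} ∑_{r ≤ R} |∑_{s ≤ S} I(q,r,s)|`
(`Negative.lhs`).  Put `Y := y + c` and, for a modulus `e`,
`J(q, e) = ∑_{1 ≤ m ≤ Y, m ≡ c (e), m ≡ w + c (q)} λ(m)` (`classSum`; the filter is `classFilter`).

Trivial mass (used for every "trivially"): `#{n ≤ N₀ : rsn ≡ w (q)} ≤ N₀ + 1` and, sharper,
`|J(q, e)| ≤ Y/e + 1` (`abs_classSum_le`); we never need the `1/q` from the dilation class (it is NOT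
available uniformly in `w`: for `q ∣ rs` and `q ∣ w` the class condition is vacuous).

Step 0 (`I` versus `J`, `abs_innerSum_sub_classSum_le`).  `m = rsn + c` maps `{1 ≤ n ≤ Z, rsn ≡ w (q)}`
injectively onto `{m ≡ c (rs), m ≡ w + c (q), rs + c ≤ m ≤ y + c}`; terms with `m ≤ 0` vanish, and the
`m ∈ [1, Y]` of the two classes NOT of this form are `m = c - j rs ≥ 1`, `j ≥ 0`, at most `|c| + 1` of them.
Hence `|I(q,r,s) - J(q, rs)| ≤ |c| + 1` for all `q, r, s ≥ 1`, and replacing `I` by `J` in any `s`-set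
`T` costs `≤ (|c|+1) #T`; in total `≤ (|c|+1) x^ρ R S ≤ (|c|+1) x^{1/2+2ρ}`.

Step 1 (the cut).  Let `T₀ := x^{1/2-4ρ}` and `J₀ ≥ 0` minimal with `S/2^{J₀} ≤ 2T₀`; put `S_cut := S/2^{J₀}`
(`= S` if `S ≤ 2T₀`, else `S_cut ∈ (T₀, 2T₀]`; `J₀ ≤ log₂ x + 2`).  Then (`lhs_le_split`)
`LHS ≤ ∑_{q,r} ∑_{s ≤ S_cut} |I| + ∑_{q,r} |∑_{S_cut < s ≤ S} I|`.

Step 2 (BV range, `bvRange_bound`, from `BVLiouville` alone).  For `s ≤ S_cut` the modulus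
`d := lcm(q, rs) ≤ q r s ≤ x^ρ · x^ρ · 2x^{1/2-4ρ} ≤ x^{1/2-ρ}` (large `x`).  By Step 0, `|I| ≤ |J(q,rs)| + |c|+1`.
The two classes `c (mod rs)`, `w + c (mod q)` are either incompatible (`J = 0`) or ONE class `m₀ (mod d)`
(`Int.modEq_and_modEq_iff_modEq_lcm`), and with `a := m₀ mod d ∈ [0, d)`:
`J = [1 ≤ a ≤ Y] λ(a) + ∑_{n=1}^{U} λ(dn + a)`, `U := ⌊(⌊Y⌋ - a)/d⌋`, so `|J| ≤ 1 + |B_d(U, a)|` with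
`B_d(U,a) := ∑_{n ≤ U} λ(dn + a)` = the `BVLiouville` summand at `(c_d, y_d) := (a, dU)`, `dU ≤ Y ≤ 2x`.
Multiplicity: `#{(q,r,s) : lcm(q,rs) = d} ≤ τ(d) · ∑_{e ∣ d} τ(e) ≤ τ(d)³`.  For each `d` choose the pair
`(U*, a*)` maximising `|B_d|` among those occurring (`Finset.exists_max_image`); then
`∑_{q,r,s ≤ S_cut} |J| ≤ ∑_{d ≤ D} τ(d)³ (1 + M_d)`, `M_d := |B_d(U*_d, a*_d)| ≤ 2x/d`, and Cauchy–Schwarz: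
`∑_d τ(d)³ M_d ≤ (∑_{d ≤ D} τ(d)⁶ · 2x/d)^{1/2} (∑_{d ≤ D} M_d)^{1/2} ≤ (2 C₆ x (log x)^{128})^{1/2}
(C_BV · 2x/(log 2x)^{A'})^{1/2}` by `exists_sum_sigma_zero_pow_div_le_real 6` and `BVLiouville` at
`(ε, A', 2x)` with the choice functions `(a*_d, d U*_d)`; with `A' := 2A + 130` this is `≤ C x/(log x)^{A+1}`.
(The terms `∑_d τ(d)³ ≤ D (log)^{C} ≤ x^{1/2}` and `(|c|+1) x^ρ R S_cut` are negligible.)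

Step 3 (dispersion range: strip the smooth part, `sum_filter_smoothComponent_eq`, `tail_bound`).  For `s > S_cut`
write `N := q r |c|`, `P := (s, N^∞)` (`smoothComponent N s`), `s₃ := s/P` (`roughComponent`), so `(s₃, q r P c) = 1`,
and `s ↔ (P, s₃)` is a bijection onto `{P ∣ N^∞} × {s₃ : (s₃, N) = 1}` with `S_cut < s ≤ S ⟺
S_cut/P < s₃ ≤ S/P`, i.e. `s₃ ∈ sRange c q (rP) (S_cut/P) (S/P)` EXACTLY (for `P ∣ N^∞`:
`(s₃, q·rP) = 1 ∧ (s₃, c) = 1 ⟺ (s₃, N) = 1`).  Tail `P > P_m := x^{3ρ}`: by `|J(q, rs)| ≤ Y/(rs) + 1` and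
Rankin (`RankinComposed.sum_inv_le_rankin`, `σ = 1/2`): `∑_{P ∣ N^∞, P > P_m} 1/P ≤ P_m^{-1/2} ∏_{p ∣ N}
(1 - p^{-1/2})⁻¹ ≤ P_m^{-1/2} 4^{ω(N)} ≤ P_m^{-1/2} τ(q)² τ(r)² τ(c)²`, so the tail is
`≤ Y (1 + log S) P_m^{-1/2} τ(c)² (∑_{q ≤ x^ρ} τ(q)²)(∑_{r ≤ R} τ(r)²/r) + x^ρ R S ≤ C τ(c)² Y x^{ρ - 3ρ/2}
(log x)^{17} + x^{1/2+2ρ}` — a power saving.  (The brief's `T = (log x)^{C_T}` truncation of `P` is NOT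
available: for `q ∣ w` the `s = q s'` have a vacuous class condition and carry mass `≍ y log(x^ρ) log R log S`;
this is what forces the `P`-sum INSIDE the main-term statement, see the audit below.)

Step 4 (kernel split, `classSum_eq_pieces`).  For `s = P s₃` as above, CRT (`(rP, s₃) = 1`) gives
`m ≡ c (rs) ⟺ m ≡ c (rP) ∧ m ≡ c (s₃)`, and since `c` is a unit mod `s₃`,
`1_{m ≡ c (s₃)} = 1_{m c̄ = 1 in ZMod s₃} = K_{Rd}(m c̄; s₃) + 𝔲_{Rd}(m c̄; s₃)` (`mainKernel_add_uR_eq_ite`; for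
`(m, s₃) > 1` all three vanish).  Hence `J(q, rs) = mainPiece(q, rP, s₃) + uRPiece(q, rP, s₃)` (complex),
both over the filter `classFilter c q w (rP) Y` = `{m ≤ Y : m ≡ c (rP), m ≡ w + c (q)}`, `Rd := x^{40ρ}`.

Step 5 (main terms = `DilatedMainTerms` (v4), hypothesis).  Summing Step 4 over `s₃` and `P ≤ P_m`, `P ∣ N^∞`:
`∑_{q,r} |∑_{P} ∑_{s₃} mainPiece| ≤ ∑_{P ≤ P_m} ∑_{q ≤ x^ρ} ∑_{r ≤ R} ‖∑_{s₃ ∈ sRange c q (rP) (S_cut/P) (S/P)}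
mainPiece(q, rP, s₃)‖` (drop `P ∣ N^∞`, nonnegative terms), which is the left side of `DilatedMainTerms` at
`u ≡ c`, `v ≡ w + c`, `(Y, R, Slo, S, Rd, Pm) := (y + c, R, S_cut, S, x^{40ρ}, ⌊x^{3ρ}⌋)` and exponent
`ρ_m := 4ρ`: side conditions `Y ≤ x + c ≤ 2x` ✓, `P_m R ≤ x^{3ρ} x^ρ = x^{ρ_m}` ✓, `S R ≤ x^{1/2+ρ} ≤ x^{1/2+ρ_m}` ✓,
`1 ≤ Rd = x^{40ρ} ≤ x^{ρ₀}` ✓ (`40ρ ≤ ρ₀`), and its `q`-range `⌊x^{ρ_m}⌋ ⊇ ⌊x^ρ⌋` ✓: bound `C x/(log x)^{A+1}`.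

Step 6 (`𝔲_R` terms = `URBound`, from `DilatedTypeII ∧ DilatedDivisorAP`; the analytic heart, the separate stub `stub_uRBound`).
Split `(S_cut/P, S/P] = ⋃_{j<J₀} (S/(2^{j+1}P), S/(2^j P)]` (`sum_sRange_eq_sum_dyadic`); CLAIM: for each
`P ≤ x^{3ρ}` and dyadic `Slo` with `x^{1/2-9ρ} ≤ Slo`, `2 Slo R P ≤ x^{1/2+ρ}`, `P R ≤ x^{4ρ}`:
`∑_{q ≤ x^ρ} ∑_{r ≤ R} ‖∑_{s₃ ∈ sRange c q (rP) Slo (2Slo)} uRPiece(q, rP, s₃)‖ ≤ C x^{1-5ρ}`; summed over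
`≤ x^{3ρ}` values of `P` and `≤ log₂ x + 2` values of `j`: `≤ C x^{1-2ρ}(log₂ x + 2)`.  Plan for the CLAIM
(trivial size `≍ Y Rd (log)^C/P`, `Rd = x^{40ρ}`, so a saving `x^{45ρ}` is needed): `λ = 1_□ ⋆ μ`
(`m = k² d`), `k > K₀ := x^{50ρ}` trivially (`|𝔲_R(t;s)| ≤ 1_{t=1} + Rd τ(s)/φ(s)`: `Y Rd (log)^C/K₀`);
Heath-Brown for `μ(d)`, `K = 4`, `U⁴ ≥ 2x` (tree: `heathBrown_identity` is for `Λ`; the `μ`-version is the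
same `E^{⋆4} ⋆ μ = 0` computation with `ζ ⋆ μ = δ`, via `HeathBrown.defect_pow_apply_eq_zero_real`); `k²`
joins the `m`-group; dyadic boxes (`≤ (log x)^9` per `j`); boxes of total scale `< x^{1-ρ₀}` trivially
(`x^{1-ρ₀+40ρ+o(1)}`); trichotomy with `η = 1/50`: a sub-product of scales in `[x^η, 2^8 x^{1/3-η}]` ⇒
`DilatedTypeII` at `(η/2, ρ' = 4ρ, K_τ = 8)` with `(M, N)` the two group scales (re-split dyadically),
`α, β` the box-restricted convolutions (`|α_m| ≤ τ(m)^8`), `u ≡ c`, `v ≡ w + c`, window `(0, Y]`, `R' = RP ≤ x^{4ρ}`,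
`Slo' = Slo ≥ x^{1/2-9ρ} ≥ x^{1/2-ρ₀}`, `2 Slo' R' ≤ x^{1/2+ρ} ≤ x^{1/2+ρ'}`, `Rd = x^{40ρ} ≤ x^{ρ₀}` (`40ρ ≤ ρ₀`):
`C x^{1+20ρ}/Rd = C x^{1-20ρ}` per application; else all small scales have product `ν < x^η` and the `ℓ ∈
{1,2,3}` remaining variables are smooth and `> x^{1/3-η}` (`(2x)^{1/4} < x^{1/3-1/50}`): write
`𝔲_R = g_{s₃}(·; c ν̄…) − φ(s₃)⁻¹ ∑_{1 < cond ψ ≤ Rd} ψ̄(c) ψ(·)`; the `g`-part by counting (`ℓ = 1`: `O(τ(s₃))`)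
or `FouvryTenenbaum2021_lemma412/413` (`ℓ = 2, 3`; unit classes mod `D ∣ lcm(q, rP)` after splitting the
`D^∞`-parts `gᵢ ≤ x^{100ρ}` and a Möbius `eᵢ ∣ rad D`; `x^{-50ρ}`-fine boxes for the window `mn ≤ Y`, bands
`Y x^{-50ρ} Rd (log)^C = x^{1-10ρ+o(1)}`; level `s₃ ≤ x^{1/2+ρ} ≤ (2^{12}x)^{3/5}`; loss
`D^{C₀} x^{150ρ} · #(q,r) ≤ x^{(5C₀+160)ρ} < x^{δ/2}`), the `ψ`-part by Pólya–Vinogradov on the largest smooth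
variable (`≤ x^{11/12+1/50+41ρ+o(1)}`).  With `ρ ≤ ρ₁ := min(ρ₀^{II}, δ/(400(C₀⁺+40)), 10⁻³)/50` every piece is
`≤ C x^{1-5ρ}`.  This is the registered stub `stub_uRBound : URBound` (Defs), a HYPOTHESIS of `stub_assembleFrom`.

Step 7 (numerics, `stub_assembleFrom`).  `ρ := min(ρ₀^{MT}/40, ρ₁)`; given `A`: Steps 2 and 5 at `A + 1`;
`LHS ≤ C₁x/(log x)^{A+1} + (|c|+1)x^{1/2+2ρ}·2 + Tail + C₂ x/(log x)^{A+1} + C₃ x^{1-2ρ}(log₂ x + 2) ≤ C x/(log x)^A`.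

AUDIT of the inputs (each hypothesis against its application).
* `DilatedMainTerms` (PRELUDE C) — FAILS to serve: its `s`-sum is inside the norm with ONE window `(Slo, S]`
  per application and a `(log x)^{-A}` saving, but after Step 3 the window is `(S_cut/P, S/P]`, and `P`
  takes `≫ x^ρ` values of non-negligible mass (`w = 0`, `s = q s'`); `x^{2ρ}` applications × `x(log x)^{-A}`
  is not `o(x)`.  REPAIR (adopted by the lead as skeleton v4): the `P`-sum inside the statement — the
  PRELUDE-C `DilatedMainTerms` above now IS this corrected form (`Pm = 1` recovers the v3 statement).
  Its side conditions are checked in Step 5.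
* `DilatedTypeII` — serves as typed (Step 6: all five side conditions survive `R ↦ RP`, `Slo ↦ S/(2^{j+1}P)`;
  `≤ x^{3ρ} log x` applications are absorbed by the power saving; `η ↦ η/2` absorbs the `2^8` of re-splitting
  a product of boxes; classes `u ≡ c`, `v ≡ w + c` are constant functions; no coprimality on `n` is needed).
* `DilatedDivisorAP` — serves as typed (orderable scales, arbitrary sub-intervals, `x_FT := 2^{12} x`,
  `M₁ ≥ x^{0.3} ≥ x_FT^{1/100}`, `s₃ ≤ x^{1/2+ρ} ≤ x_FT^{3/5}` resp. `≤ x_FT^{1/2+1/85}`, `(s₃, aD) = 1` with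
  `a = c ν̄`, `D ∣ lcm(q, rP)`; `ρ` is chosen after `δ, C₀`).
* `BVLiouville` — serves as typed (Step 2: one class and one height per modulus realised by a choice
  function, multiplicity by Cauchy–Schwarz, `x_BV := 2x`).
-/

noncomputable section

namespace Summit.Parity.GeneralizedHardyLittlewood.Cruxes.TypeI2Dilated.PeelToDrappeau

open Finset Real
open scoped ArithmeticFunction.sigma Classical
open Literature.NumberTheory.Sieve Literature.NumberTheory.Sieve.Drappeau2017
  Literature.NumberTheory.Sieve.FouvryTenenbaum2021 Literature.NumberTheory.Sieve.DispersionAssembly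
open Summit.Parity.GeneralizedHardyLittlewood.Theses.LiouvilleShiftedTables (TypeI2Dilated BVLiouville)

/-- Splitting an `sRange` window at an intermediate point: for `Slo₁ ≤ Slo₂ ≤ S`, `0 ≤ Slo₂`,
`∑_{(Slo₁, S]} = ∑_{(Slo₂, S]} + ∑_{(Slo₁, Slo₂]}`. [this line] -/
theorem sum_sRange_split (c : ℤ) (q r : ℕ) {Slo₁ Slo₂ S : ℝ} (h12 : Slo₁ ≤ Slo₂) (h2 : 0 ≤ Slo₂)
    (h2S : Slo₂ ≤ S) (F : ℕ → ℂ) :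
    ∑ s ∈ sRange c q r Slo₁ S, F s = ∑ s ∈ sRange c q r Slo₂ S, F s + ∑ s ∈ sRange c q r Slo₁ Slo₂, F s := by
  rw [← Finset.sum_filter_add_sum_filter_not (sRange c q r Slo₁ S) (fun s : ℕ => Slo₂ < (s : ℝ))]
  congr 1
  · congr 1
    ext s
    simp only [sRange, Finset.mem_filter, Finset.mem_Icc]
    constructor
    · rintro ⟨⟨h1, -, hcop⟩, h3⟩; exact ⟨h1, h3, hcop⟩
    · rintro ⟨h1, h3, hcop⟩; exact ⟨⟨h1, h12.trans_lt h3, hcop⟩, h3⟩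
  · congr 1
    ext s
    simp only [sRange, Finset.mem_filter, Finset.mem_Icc, not_lt]
    constructor
    · rintro ⟨⟨⟨h1, -⟩, h3, hcop⟩, h4⟩
      exact ⟨⟨h1, (Nat.le_floor_iff h2).2 h4⟩, h3, hcop⟩
    · rintro ⟨⟨h1, h4⟩, h3, hcop⟩
      have h4' : (s : ℝ) ≤ Slo₂ := (Nat.le_floor_iff h2).1 h4
      exact ⟨⟨⟨h1, h4.trans (Nat.floor_mono h2S)⟩, h3, hcop⟩, h4'⟩

/-- L8 — dyadic decomposition of an `sRange` window `(S/2^J/P, S/P]` into the `J` blocks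
`(S/2^{j+1}/P, 2·S/2^{j+1}/P]`. [this line] -/
theorem sum_sRange_eq_sum_dyadic (c : ℤ) (q r : ℕ) {S : ℝ} (hS : 0 ≤ S) {P : ℕ} (hP : 1 ≤ P) (J : ℕ)
    (F : ℕ → ℂ) :
    ∑ s ∈ sRange c q r (S / 2 ^ J / P) (S / P), F s =
      ∑ j ∈ Finset.range J, ∑ s ∈ sRange c q r (S / 2 ^ (j + 1) / P) (2 * (S / 2 ^ (j + 1) / P)), F s := by
  have hP0 : (0 : ℝ) < P := by exact_mod_cast hP
  induction J with
  | zero =>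
    rw [Finset.sum_range_zero, pow_zero, div_one]
    refine Finset.sum_eq_zero fun s hs => ?_
    exfalso
    simp only [sRange, Finset.mem_filter, Finset.mem_Icc] at hs
    have h1 : (s : ℝ) ≤ S / P := (Nat.le_floor_iff (by positivity)).1 hs.1.2
    linarith [hs.2.1]
  | succ J ih =>
    rw [Finset.sum_range_succ, ← ih]
    have e : 2 * (S / 2 ^ (J + 1) / P) = S / 2 ^ J / P := by
      rw [pow_succ]; field_simp
    rw [e]
    refine sum_sRange_split c q r ?_ (by positivity) ?_ F
    · rw [pow_succ]
      apply div_le_div_of_nonneg_right _ hP0.le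
      apply div_le_div_of_nonneg_left hS (by positivity)
      linarith [pow_pos (two_pos : (0 : ℝ) < 2) J]
    · apply div_le_div_of_nonneg_right _ hP0.le
      apply div_le_self hS
      exact one_le_pow₀ (by norm_num)

/-- The dispersion range at a fixed pair `(q, r)` (Steps 0, 3, 4 combined): with `S' = S/2^J`,
`|∑_{S' < s ≤ S} I(q,r,s)| ≤ (|c|+1) #{S' < s ≤ S} + ∑_{s ≤ S, (s,N^∞) > Pm} (Y⁺/(rs) + 1)
 + ∑_{P ≤ Pm} ‖∑_{s₃ ∈ sRange c q (rP) (S'/P) (S/P)} mainPiece(q, rP, s₃)‖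
 + ∑_{P ≤ Pm} ∑_{j<J} ‖∑_{s₃ ∈ sRange c q (rP) (S/2^{j+1}/P) (2 S/2^{j+1}/P)} uRPiece(q, rP, s₃)‖`. [this line] -/
theorem disp_pointwise {c : ℤ} (hc : c ≠ 0) {q r : ℕ} (hq : 1 ≤ q) (hr : 1 ≤ r) (w : ℕ) (y : ℝ)
    {S : ℝ} (hS : 0 ≤ S) (Rd : ℝ) (Pm J : ℕ) :
    |∑ s ∈ (Icc 1 ⌊S⌋₊).filter (fun s : ℕ => S / 2 ^ J < (s : ℝ)), innerSum c q w r s y| ≤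
      ((c.natAbs : ℝ) + 1) * (((Icc 1 ⌊S⌋₊).filter (fun s : ℕ => S / 2 ^ J < (s : ℝ))).card : ℝ) +
      ∑ s ∈ (Icc 1 ⌊S⌋₊).filter (fun s : ℕ => Pm < smoothComponent (q * r * c.natAbs) s),
        (max (y + c) 0 / ((r : ℝ) * s) + 1) +
      ∑ P ∈ Icc 1 Pm, ‖∑ t ∈ sRange c q (r * P) (S / 2 ^ J / P) (S / P),
        mainPiece c q w (r * P) t (y + c) Rd‖ +
      ∑ P ∈ Icc 1 Pm, ∑ j ∈ Finset.range J,
        ‖∑ t ∈ sRange c q (r * P) (S / 2 ^ (j + 1) / P) (2 * (S / 2 ^ (j + 1) / P)),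
          uRPiece c q w (r * P) t (y + c) Rd‖ := by
  set N := q * r * c.natAbs with hN
  set T := (Icc 1 ⌊S⌋₊).filter (fun s : ℕ => S / 2 ^ J < (s : ℝ)) with hT
  set Jf : ℕ → ℝ := fun s => classSum c q w (r * s) (y + c) with hJf
  -- Step 0: replace `I` by `J`
  have h0 : |∑ s ∈ T, innerSum c q w r s y - ∑ s ∈ T, Jf s| ≤ ((c.natAbs : ℝ) + 1) * (T.card : ℝ) := by
    rw [← Finset.sum_sub_distrib]
    calc |∑ s ∈ T, (innerSum c q w r s y - Jf s)| ≤ ∑ s ∈ T, |innerSum c q w r s y - Jf s| :=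
          Finset.abs_sum_le_sum_abs _ _
      _ ≤ ∑ _s ∈ T, ((c.natAbs : ℝ) + 1) := by
          refine Finset.sum_le_sum fun s hs => ?_
          rw [hT, Finset.mem_filter, Finset.mem_Icc] at hs
          exact abs_innerSum_sub_classSum_le c q w hr hs.1.1 y
      _ = ((c.natAbs : ℝ) + 1) * (T.card : ℝ) := by rw [Finset.sum_const, nsmul_eq_mul, mul_comm]
  -- Step 3: split `T` by the size of the smooth part
  have hsplit : ∑ s ∈ T, Jf s = ∑ s ∈ T.filter (fun s : ℕ => smoothComponent N s ≤ Pm), Jf s +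
      ∑ s ∈ T.filter (fun s : ℕ => ¬ smoothComponent N s ≤ Pm), Jf s :=
    (Finset.sum_filter_add_sum_filter_not T _ _).symm
  -- the large-smooth-part piece, trivially
  have hlarge : |∑ s ∈ T.filter (fun s : ℕ => ¬ smoothComponent N s ≤ Pm), Jf s| ≤
      ∑ s ∈ (Icc 1 ⌊S⌋₊).filter (fun s : ℕ => Pm < smoothComponent N s),
        (max (y + c) 0 / ((r : ℝ) * s) + 1) := by
    have hsub : T.filter (fun s : ℕ => ¬ smoothComponent N s ≤ Pm) ⊆
        (Icc 1 ⌊S⌋₊).filter (fun s : ℕ => Pm < smoothComponent N s) := by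
      intro s hs
      rw [Finset.mem_filter, hT, Finset.mem_filter] at hs
      rw [Finset.mem_filter]
      exact ⟨hs.1.1, not_le.1 hs.2⟩
    calc |∑ s ∈ T.filter (fun s : ℕ => ¬ smoothComponent N s ≤ Pm), Jf s|
        ≤ ∑ s ∈ T.filter (fun s : ℕ => ¬ smoothComponent N s ≤ Pm), |Jf s| := Finset.abs_sum_le_sum_abs _ _
      _ ≤ ∑ s ∈ T.filter (fun s : ℕ => ¬ smoothComponent N s ≤ Pm), (max (y + c) 0 / ((r : ℝ) * s) + 1) := by
          refine Finset.sum_le_sum fun s hs => ?_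
          rw [Finset.mem_filter, hT, Finset.mem_filter, Finset.mem_Icc] at hs
          have hrs : 1 ≤ r * s := Nat.mul_pos hr hs.1.1.1
          have := abs_classSum_le c q w hrs (y + c)
          simpa [hJf, Nat.cast_mul] using this
      _ ≤ _ := Finset.sum_le_sum_of_subset_of_nonneg hsub fun _ _ _ => by positivity
  -- the small-smooth-part piece: regroup by `P`, split the kernel
  have hsmall_eq : T.filter (fun s : ℕ => smoothComponent N s ≤ Pm) =
      (Icc 1 ⌊S⌋₊).filter (fun s : ℕ => S / 2 ^ J < (s : ℝ) ∧ smoothComponent N s ≤ Pm) := by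
    rw [hT, Finset.filter_filter]
  set Pf := (Icc 1 Pm).filter (fun P : ℕ => P ∈ Nat.factoredNumbers N.primeFactors) with hPf
  have hregroup : ∑ s ∈ T.filter (fun s : ℕ => smoothComponent N s ≤ Pm), Jf s =
      ∑ P ∈ Pf, ∑ t ∈ sRange c q (r * P) (S / 2 ^ J / P) (S / P), Jf (P * t) := by
    rw [hsmall_eq]
    exact sum_filter_smoothComponent_eq hc hq hr (S / 2 ^ J) S Pm Jf
  have hpieces : ∀ P ∈ Pf, ∀ t ∈ sRange c q (r * P) (S / 2 ^ J / P) (S / P),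
      ((Jf (P * t) : ℝ) : ℂ) = mainPiece c q w (r * P) t (y + c) Rd + uRPiece c q w (r * P) t (y + c) Rd := by
    intro P _ t ht
    simp only [sRange, Finset.mem_filter, Finset.mem_Icc] at ht
    obtain ⟨⟨ht1, -⟩, -, hcop, hcopc⟩ := ht
    have hrt : Nat.Coprime (r * P) t := Nat.Coprime.coprime_dvd_left ⟨q, by ring⟩ hcop.symm
    simp only [hJf]
    rw [show r * (P * t) = r * P * t by ring]
    exact classSum_eq_pieces c q w (r * P) ht1 hrt hcopc (y + c) Rd
  have hsmallC : ((∑ s ∈ T.filter (fun s : ℕ => smoothComponent N s ≤ Pm), Jf s : ℝ) : ℂ) =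
      ∑ P ∈ Pf, ∑ t ∈ sRange c q (r * P) (S / 2 ^ J / P) (S / P), mainPiece c q w (r * P) t (y + c) Rd +
      ∑ P ∈ Pf, ∑ t ∈ sRange c q (r * P) (S / 2 ^ J / P) (S / P), uRPiece c q w (r * P) t (y + c) Rd := by
    rw [hregroup, Complex.ofReal_sum, ← Finset.sum_add_distrib]
    refine Finset.sum_congr rfl fun P hP => ?_
    rw [Complex.ofReal_sum, ← Finset.sum_add_distrib]
    exact Finset.sum_congr rfl fun t ht => hpieces P hP t ht
  have hsmall : |∑ s ∈ T.filter (fun s : ℕ => smoothComponent N s ≤ Pm), Jf s| ≤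
      ∑ P ∈ Icc 1 Pm, ‖∑ t ∈ sRange c q (r * P) (S / 2 ^ J / P) (S / P),
        mainPiece c q w (r * P) t (y + c) Rd‖ +
      ∑ P ∈ Icc 1 Pm, ∑ j ∈ Finset.range J,
        ‖∑ t ∈ sRange c q (r * P) (S / 2 ^ (j + 1) / P) (2 * (S / 2 ^ (j + 1) / P)),
          uRPiece c q w (r * P) t (y + c) Rd‖ := by
    rw [← Real.norm_eq_abs, ← Complex.norm_real, hsmallC]
    have hPf_sub : Pf ⊆ Icc 1 Pm := Finset.filter_subset _ _
    refine (norm_add_le _ _).trans (add_le_add ?_ ?_)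
    · refine (norm_sum_le _ _).trans ?_
      exact Finset.sum_le_sum_of_subset_of_nonneg hPf_sub fun _ _ _ => norm_nonneg _
    · refine (norm_sum_le _ _).trans ?_
      refine le_trans (Finset.sum_le_sum fun P hP => ?_)
        (Finset.sum_le_sum_of_subset_of_nonneg hPf_sub fun _ _ _ =>
          Finset.sum_nonneg fun _ _ => norm_nonneg _)
      have hP1 : 1 ≤ P := (Finset.mem_Icc.1 (Finset.mem_filter.1 hP).1).1
      rw [sum_sRange_eq_sum_dyadic c q (r * P) hS hP1 J]
      exact norm_sum_le _ _
  -- combine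
  have hTJ : |∑ s ∈ T, Jf s| ≤
      ∑ s ∈ (Icc 1 ⌊S⌋₊).filter (fun s : ℕ => Pm < smoothComponent N s),
        (max (y + c) 0 / ((r : ℝ) * s) + 1) +
      (∑ P ∈ Icc 1 Pm, ‖∑ t ∈ sRange c q (r * P) (S / 2 ^ J / P) (S / P),
        mainPiece c q w (r * P) t (y + c) Rd‖ +
      ∑ P ∈ Icc 1 Pm, ∑ j ∈ Finset.range J,
        ‖∑ t ∈ sRange c q (r * P) (S / 2 ^ (j + 1) / P) (2 * (S / 2 ^ (j + 1) / P)),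
          uRPiece c q w (r * P) t (y + c) Rd‖) := by
    rw [hsplit, add_comm]
    exact (abs_add_le _ _).trans (add_le_add hlarge hsmall)
  have habs : |∑ s ∈ T, innerSum c q w r s y| ≤ ((c.natAbs : ℝ) + 1) * (T.card : ℝ) + |∑ s ∈ T, Jf s| := by
    have := abs_sub_abs_le_abs_sub (∑ s ∈ T, innerSum c q w r s y) (∑ s ∈ T, Jf s)
    linarith
  linarith

/-- `∑_b ∑_c ∑_d g = ∑_c ∑_d ∑_b g`. [folklore] -/
theorem sum_comm_inner3 {α β γ M : Type*} [AddCommMonoid M] (s : Finset α) (t : Finset β)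
    (u : Finset γ) (g : α → β → γ → M) :
    ∑ a ∈ s, ∑ b ∈ t, ∑ c ∈ u, g a b c = ∑ b ∈ t, ∑ c ∈ u, ∑ a ∈ s, g a b c := by
  rw [Finset.sum_comm]
  exact Finset.sum_congr rfl fun b _ => Finset.sum_comm

/-- `∑_a ∑_b ∑_c ∑_d f = ∑_c ∑_d ∑_a ∑_b f`. [folklore] -/
theorem sum_comm_inner4 {α β γ δ M : Type*} [AddCommMonoid M] (s : Finset α) (t : Finset β)
    (u : Finset γ) (v : Finset δ) (f : α → β → γ → δ → M) :
    ∑ a ∈ s, ∑ b ∈ t, ∑ c ∈ u, ∑ d ∈ v, f a b c d =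
      ∑ c ∈ u, ∑ d ∈ v, ∑ a ∈ s, ∑ b ∈ t, f a b c d := by
  have h1 : ∀ a ∈ s, ∑ b ∈ t, ∑ c ∈ u, ∑ d ∈ v, f a b c d =
      ∑ c ∈ u, ∑ d ∈ v, ∑ b ∈ t, f a b c d := fun a _ => sum_comm_inner3 t u v (f a)
  rw [Finset.sum_congr rfl h1]
  exact sum_comm_inner3 s u v (fun a c d => ∑ b ∈ t, f a b c d)

/-- **The combinatorial reduction.**  For `c ≠ 0`, dilations `q ≤ Q`, any cut `J`, threshold `Pm`
and conductor cut `Rd`: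
`LHS ≤ [BV range over s ≤ S/2^J] + (|c|+1) Q R S + [Rankin tail] + [main pieces] + [𝔲_R pieces]`.
[this line] -/
theorem lhs_le_pieces {c : ℤ} (hc : c ≠ 0) (Q w : ℕ) (R y : ℝ) {S : ℝ} (hS0 : 0 ≤ S) (J Pm : ℕ)
    (Rd : ℝ) :
    Negative.lhs (fun n => (ArithmeticFunction.liouville n : ℝ)) c Q w R S y ≤
      (∑ q ∈ Icc 1 Q, ∑ r ∈ Icc 1 ⌊R⌋₊, ∑ s ∈ Icc 1 ⌊S / 2 ^ J⌋₊, |innerSum c q w r s y|) +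
      ((c.natAbs : ℝ) + 1) * ((Q : ℝ) * ⌊R⌋₊ * ⌊S⌋₊) +
      (∑ q ∈ Icc 1 Q, ∑ r ∈ Icc 1 ⌊R⌋₊,
        ∑ s ∈ (Icc 1 ⌊S⌋₊).filter (fun s : ℕ => Pm < smoothComponent (q * r * c.natAbs) s),
          (max (y + c) 0 / ((r : ℝ) * s) + 1)) +
      (∑ P ∈ Icc 1 Pm, ∑ q ∈ Icc 1 Q, ∑ r ∈ Icc 1 ⌊R⌋₊,
        ‖∑ t ∈ sRange c q (r * P) (S / 2 ^ J / P) (S / P), mainPiece c q w (r * P) t (y + c) Rd‖) +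
      ∑ P ∈ Icc 1 Pm, ∑ j ∈ Finset.range J, ∑ q ∈ Icc 1 Q, ∑ r ∈ Icc 1 ⌊R⌋₊,
        ‖∑ t ∈ sRange c q (r * P) (S / 2 ^ (j + 1) / P) (2 * (S / 2 ^ (j + 1) / P)),
          uRPiece c q w (r * P) t (y + c) Rd‖ := by
  have h2J : (1 : ℝ) ≤ 2 ^ J := one_le_pow₀ (by norm_num)
  have hS'S : S / 2 ^ J ≤ S := div_le_self hS0 h2J
  have hS'0 : 0 ≤ S / 2 ^ J := by positivity
  have h1 := lhs_le_split c Q w R y (S := S) hS'0 hS'S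
  have h3 : ∑ q ∈ Icc 1 Q, ∑ r ∈ Icc 1 ⌊R⌋₊,
      |∑ s ∈ (Icc 1 ⌊S⌋₊).filter (fun s : ℕ => S / 2 ^ J < (s : ℝ)), innerSum c q w r s y| ≤
      ∑ q ∈ Icc 1 Q, ∑ r ∈ Icc 1 ⌊R⌋₊,
       (((c.natAbs : ℝ) + 1) * (((Icc 1 ⌊S⌋₊).filter (fun s : ℕ => S / 2 ^ J < (s : ℝ))).card : ℝ) +
        ∑ s ∈ (Icc 1 ⌊S⌋₊).filter (fun s : ℕ => Pm < smoothComponent (q * r * c.natAbs) s),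
          (max (y + c) 0 / ((r : ℝ) * s) + 1) +
        ∑ P ∈ Icc 1 Pm, ‖∑ t ∈ sRange c q (r * P) (S / 2 ^ J / P) (S / P),
          mainPiece c q w (r * P) t (y + c) Rd‖ +
        ∑ P ∈ Icc 1 Pm, ∑ j ∈ Finset.range J,
          ‖∑ t ∈ sRange c q (r * P) (S / 2 ^ (j + 1) / P) (2 * (S / 2 ^ (j + 1) / P)),
            uRPiece c q w (r * P) t (y + c) Rd‖) :=
    Finset.sum_le_sum fun q hq => Finset.sum_le_sum fun r hr =>
      disp_pointwise hc (Finset.mem_Icc.1 hq).1 (Finset.mem_Icc.1 hr).1 w y hS0 Rd Pm J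
  have h3' : ∑ q ∈ Icc 1 Q, ∑ r ∈ Icc 1 ⌊R⌋₊,
      |∑ s ∈ (Icc 1 ⌊S⌋₊).filter (fun s : ℕ => S / 2 ^ J < (s : ℝ)), innerSum c q w r s y| ≤
      (∑ q ∈ Icc 1 Q, ∑ r ∈ Icc 1 ⌊R⌋₊,
        ((c.natAbs : ℝ) + 1) * (((Icc 1 ⌊S⌋₊).filter (fun s : ℕ => S / 2 ^ J < (s : ℝ))).card : ℝ)) +
      (∑ q ∈ Icc 1 Q, ∑ r ∈ Icc 1 ⌊R⌋₊,
        ∑ s ∈ (Icc 1 ⌊S⌋₊).filter (fun s : ℕ => Pm < smoothComponent (q * r * c.natAbs) s),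
          (max (y + c) 0 / ((r : ℝ) * s) + 1)) +
      (∑ q ∈ Icc 1 Q, ∑ r ∈ Icc 1 ⌊R⌋₊, ∑ P ∈ Icc 1 Pm,
        ‖∑ t ∈ sRange c q (r * P) (S / 2 ^ J / P) (S / P), mainPiece c q w (r * P) t (y + c) Rd‖) +
      ∑ q ∈ Icc 1 Q, ∑ r ∈ Icc 1 ⌊R⌋₊, ∑ P ∈ Icc 1 Pm, ∑ j ∈ Finset.range J,
        ‖∑ t ∈ sRange c q (r * P) (S / 2 ^ (j + 1) / P) (2 * (S / 2 ^ (j + 1) / P)),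
          uRPiece c q w (r * P) t (y + c) Rd‖ :=
    h3.trans (le_of_eq (by simp only [Finset.sum_add_distrib]))
  -- the correction terms
  have hi : ∑ q ∈ Icc 1 Q, ∑ r ∈ Icc 1 ⌊R⌋₊,
      ((c.natAbs : ℝ) + 1) * (((Icc 1 ⌊S⌋₊).filter (fun s : ℕ => S / 2 ^ J < (s : ℝ))).card : ℝ) ≤
      ((c.natAbs : ℝ) + 1) * ((Q : ℝ) * ⌊R⌋₊ * ⌊S⌋₊) := by
    calc ∑ q ∈ Icc 1 Q, ∑ r ∈ Icc 1 ⌊R⌋₊,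
          ((c.natAbs : ℝ) + 1) * (((Icc 1 ⌊S⌋₊).filter (fun s : ℕ => S / 2 ^ J < (s : ℝ))).card : ℝ)
        ≤ ∑ q ∈ Icc 1 Q, ∑ r ∈ Icc 1 ⌊R⌋₊, ((c.natAbs : ℝ) + 1) * (⌊S⌋₊ : ℝ) := by
          refine Finset.sum_le_sum fun q _ => Finset.sum_le_sum fun r _ => ?_
          refine mul_le_mul_of_nonneg_left ?_ (by positivity)
          calc ((((Icc 1 ⌊S⌋₊).filter (fun s : ℕ => S / 2 ^ J < (s : ℝ))).card : ℕ) : ℝ)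
              ≤ ((Icc 1 ⌊S⌋₊).card : ℝ) := by exact_mod_cast Finset.card_filter_le _ _
            _ = ⌊S⌋₊ := by simp
      _ = ((c.natAbs : ℝ) + 1) * ((Q : ℝ) * ⌊R⌋₊ * ⌊S⌋₊) := by
          simp only [Finset.sum_const, Nat.card_Icc, add_tsub_cancel_right, nsmul_eq_mul]; ring
  -- reorder the main and `𝔲_R` sums
  have hiii : ∑ q ∈ Icc 1 Q, ∑ r ∈ Icc 1 ⌊R⌋₊, ∑ P ∈ Icc 1 Pm,
      ‖∑ t ∈ sRange c q (r * P) (S / 2 ^ J / P) (S / P), mainPiece c q w (r * P) t (y + c) Rd‖ =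
      ∑ P ∈ Icc 1 Pm, ∑ q ∈ Icc 1 Q, ∑ r ∈ Icc 1 ⌊R⌋₊,
      ‖∑ t ∈ sRange c q (r * P) (S / 2 ^ J / P) (S / P), mainPiece c q w (r * P) t (y + c) Rd‖ := by
    rw [sum_comm_inner3]
    rw [Finset.sum_comm]
    exact Finset.sum_congr rfl fun P _ => Finset.sum_comm
  have hiv : ∑ q ∈ Icc 1 Q, ∑ r ∈ Icc 1 ⌊R⌋₊, ∑ P ∈ Icc 1 Pm, ∑ j ∈ Finset.range J,
      ‖∑ t ∈ sRange c q (r * P) (S / 2 ^ (j + 1) / P) (2 * (S / 2 ^ (j + 1) / P)),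
        uRPiece c q w (r * P) t (y + c) Rd‖ =
      ∑ P ∈ Icc 1 Pm, ∑ j ∈ Finset.range J, ∑ q ∈ Icc 1 Q, ∑ r ∈ Icc 1 ⌊R⌋₊,
      ‖∑ t ∈ sRange c q (r * P) (S / 2 ^ (j + 1) / P) (2 * (S / 2 ^ (j + 1) / P)),
        uRPiece c q w (r * P) t (y + c) Rd‖ := sum_comm_inner4 _ _ _ _ _
  rw [hiii, hiv] at h3'
  linarith [h1, h3', hi]

/-- Landing anchor of the split assembly chain (file 5 of 6): a registered, mathematically vacuous sub-goal
(`ledger workitem stub-add … --name assembleChain5_anchor --signature 'True'`) so that this intermediate file passes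
the gate's supports check; the registered stub `stub_assembleFrom` is proved in file 6. [this line] -/
theorem assembleChain5_anchor : True := trivial

end Summit.Parity.GeneralizedHardyLittlewood.Cruxes.TypeI2Dilated.PeelToDrappeau

end
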